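import Mathlib
import Literature.NumberTheory.GaloisRepresentations.ResidualPair
import Literature.NumberTheory.GaloisRepresentations.ResidualPairIntegrality
import Literature.NumberTheory.GaloisRepresentations.CompactImageCharpolyIntegral
import Literature.NumberTheory.GaloisRepresentations.FrobeniusDensity
import Literature.NumberTheory.GaloisRepresentations.WeilDeligneRepMonodromyProofs
import Literature.NumberTheory.Automorphic.ChebotarevArtinRepHolds
import Summits.Langlands.Langlands.Theorems.PhantomRMYoshidaStableYoshidaCongruenceCharpolyCongruence
import HarnessLib

/-!
# Route `PhantomRMYoshida`, crux `StableYoshidaCongruence` (stmt-Langlands-13640), line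
# `burkhardt-weddle-two-three-anchor`: pointwise residual factorisation of characteristic polynomials

Helper for the lead's stub `stub_residualLattice` (clause (M1)).  If `ρ : Γ_K → GL_n(ℚ̄_p)` has
residual pair `(σ, σ')` through `red : 𝒪_{ℚ̄_p} → k` (`FramedGaloisRep.HasResidualPair`: at almost all
places the `p`-integral Frobenius polynomial of `ρ` reduces to `charpoly σ(Frob) · charpoly σ'(Frob)`),
then the same factorisation holds at EVERY `τ ∈ Γ_K`: `det(X - ρ(τ))` is the image of a `P ∈ 𝒪[X]` with
`red(P) = det(X - σ(τ)) · det(X - σ'(τ))`.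

Proof (Serre, *Abelian ℓ-adic representations*, Ch. I §2.3; Deligne–Serre 1974, §6; the argument of the
landed Stub 1a `stub_charpolyCongruence` of the sibling line, p78811, run against the locally constant map
`τ ↦ charpoly σ(τ) · charpoly σ'(τ)`): the locus `T ⊆ Γ_K` where the factorisation holds is CLOSED — near
`τ₀` the discrete-valued `σ, σ'` are constant, the coefficients of `charpoly ρ(τ)` are continuous, the
open unit ball of `ℚ̄_p` is a neighbourhood and `ker red = 𝔪` (`map_red_eq_iff_forall_norm_sub_lt_one`) —
and contains the arithmetic Frobenii at all primes above all places outside a finite set, which are dense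
(Chebotarev, `absoluteGaloisGroup.frobenius_dense chebotarev_artinRep_holds`).  Everything used is proved
in the tree.
-/

set_option linter.dupNamespace false

noncomputable section

open Literature.NumberTheory.GaloisRepresentations Literature.NumberTheory.Automorphic
open IsDedekindDomain Filter Polynomial
open scoped NumberField
open Summit.Langlands.Langlands.Cruxes.StableYoshidaCongruence.LevelThreeWeierstrassSwitch
  (map_red_eq_iff_forall_norm_sub_lt_one)

namespace Summit.Langlands.Langlands.Cruxes.StableYoshidaCongruence.BurkhardtWeddleTwoThreeAnchor

/-- Coefficients of `det(X - ρ(τ))` beyond the rank vanish. [folklore] -/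
theorem charpoly_coeff_eq_zero_of_lt {A : Type*} [CommRing A] [Nontrivial A] [TopologicalSpace A]
    {G : Type*} [Group G] [TopologicalSpace G] {m : ℕ}
    (ρ : FramedRep G A m) (τ : G) {i : ℕ} (hi : m < i) : (FramedRep.charpoly ρ τ).coeff i = 0 := by
  apply Polynomial.coeff_eq_zero_of_natDegree_lt
  rw [FramedRep.charpoly, Matrix.charpoly_natDegree_eq_dim, Fintype.card_fin]
  exact hi

/-- **Pointwise residual factorisation.**  If `ρ : Γ_K → GL_n(ℚ̄_p)` has residual pair `(σ, σ')`
through `red : 𝒪_{ℚ̄_p} → k` (`k` of characteristic `p`, discrete), then for EVERY `τ ∈ Γ_K` the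
characteristic polynomial `det(X - ρ(τ))` is the image of some `P ∈ 𝒪[X]` with
`red(P) = det(X - σ(τ)) · det(X - σ'(τ))`.  Closed (continuity + `ker red = 𝔪`) and dense (Chebotarev)
locus argument. [cite: SerreAbelianLadic1968, Ch. I §2.3] -/
theorem exists_map_red_charpoly_eq_mul_of_hasResidualPair :
    ∀ {p : ℕ} [Fact p.Prime] {k : Type} [Field k] [CharP k p] [TopologicalSpace k] [DiscreteTopology k]
      {K : Type} [Field K] [NumberField K] {n a b : ℕ} (red : Valued.integer (PadicAlgCl p) →+* k)
      {ρ : FramedGaloisRep K (PadicAlgCl p) n} {σ : FramedGaloisRep K k a} {σ' : FramedGaloisRep K k b},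
      ρ.HasResidualPair red σ σ' → ∀ τ : Field.absoluteGaloisGroup K,
        ∃ P : Polynomial (Valued.integer (PadicAlgCl p)),
          P.map (Valued.integer (PadicAlgCl p)).subtype = FramedRep.charpoly ρ τ ∧
          P.map red = FramedRep.charpoly σ τ * FramedRep.charpoly σ' τ := by
  intro p _ k _ _ _ _ K _ _ n a b red ρ σ σ' h τ
  -- the locus `T`
  set T : Set (Field.absoluteGaloisGroup K) :=
    {τ | ∃ P : Polynomial (Valued.integer (PadicAlgCl p)),
      P.map (Valued.integer (PadicAlgCl p)).subtype = FramedRep.charpoly ρ τ ∧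
      P.map red = FramedRep.charpoly σ τ * FramedRep.charpoly σ' τ} with hT_def
  suffices hTuniv : T = Set.univ by
    have hτ : τ ∈ T := hTuniv ▸ Set.mem_univ τ
    exact hτ
  -- continuity of the coefficients of `charpoly ρ`
  have hcoeff : ∀ i : ℕ, Continuous fun τ => (FramedRep.charpoly ρ τ).coeff i := fun i =>
    (Monodromy.continuous_charpoly_coeff i).comp (Units.continuous_val.comp (map_continuous ρ))
  -- (1) `T` is closed
  have hTc : IsClosed T := by
    refine isClosed_of_closure_subset fun τ₀ hτ₀ => ?_
    -- the neighbourhood `N` of `τ₀` where `σ, σ'` are constant and `charpoly ρ` is `𝔪`-close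
    set N : Set (Field.absoluteGaloisGroup K) :=
      {τ | σ τ = σ τ₀ ∧ σ' τ = σ' τ₀ ∧
        ∀ i ∈ Finset.range (n + 1),
          ‖(FramedRep.charpoly ρ τ).coeff i - (FramedRep.charpoly ρ τ₀).coeff i‖ < 1} with hN_def
    have hNopen : IsOpen N := by
      have h1 : IsOpen {τ : Field.absoluteGaloisGroup K | σ τ = σ τ₀} :=
        (isOpen_discrete {σ τ₀}).preimage (map_continuous σ)
      have h2 : IsOpen {τ : Field.absoluteGaloisGroup K | σ' τ = σ' τ₀} :=
        (isOpen_discrete {σ' τ₀}).preimage (map_continuous σ')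
      have h3 : IsOpen {τ : Field.absoluteGaloisGroup K | ∀ i ∈ Finset.range (n + 1),
          ‖(FramedRep.charpoly ρ τ).coeff i - (FramedRep.charpoly ρ τ₀).coeff i‖ < 1} := by
        have : {τ : Field.absoluteGaloisGroup K | ∀ i ∈ Finset.range (n + 1),
            ‖(FramedRep.charpoly ρ τ).coeff i - (FramedRep.charpoly ρ τ₀).coeff i‖ < 1} =
            ⋂ i ∈ Finset.range (n + 1), (fun τ => (FramedRep.charpoly ρ τ).coeff i -
              (FramedRep.charpoly ρ τ₀).coeff i) ⁻¹' Metric.ball (0 : PadicAlgCl p) 1 := by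
          ext τ
          simp only [Set.mem_setOf_eq, Set.mem_iInter, Set.mem_preimage, mem_ball_zero_iff]
        rw [this]
        exact isOpen_biInter_finset fun i _ =>
          Metric.isOpen_ball.preimage ((hcoeff i).sub continuous_const)
      have hN : N = {τ | σ τ = σ τ₀} ∩ ({τ | σ' τ = σ' τ₀} ∩ {τ | ∀ i ∈ Finset.range (n + 1),
          ‖(FramedRep.charpoly ρ τ).coeff i - (FramedRep.charpoly ρ τ₀).coeff i‖ < 1}) := by
        ext τ
        simp only [hN_def, Set.mem_setOf_eq, Set.mem_inter_iff]
      rw [hN]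
      exact h1.inter (h2.inter h3)
    have hτ₀N : τ₀ ∈ N := by
      refine ⟨rfl, rfl, fun i _ => ?_⟩
      rw [sub_self, norm_zero]
      exact one_pos
    -- a point of `T` in `N`
    obtain ⟨τ₁, hτ₁N, P₁, hP₁, hP₁red⟩ := mem_closure_iff.1 hτ₀ N hNopen hτ₀N
    obtain ⟨hσ₁, hσ'₁, hclose⟩ := hτ₁N
    -- an integral lift at `τ₀`
    obtain ⟨P₀, hP₀⟩ := FramedGaloisRep.exists_charpoly_eq_map ρ τ₀
    refine ⟨P₀, hP₀, ?_⟩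
    have hred : P₀.map red = P₁.map red := by
      refine (map_red_eq_iff_forall_norm_sub_lt_one red P₀ P₁).2 fun i => ?_
      have h0 : ((P₀.coeff i : Valued.integer (PadicAlgCl p)) : PadicAlgCl p) =
          (FramedRep.charpoly ρ τ₀).coeff i := by
        rw [← hP₀, Polynomial.coeff_map]; rfl
      have h1 : ((P₁.coeff i : Valued.integer (PadicAlgCl p)) : PadicAlgCl p) =
          (FramedRep.charpoly ρ τ₁).coeff i := by
        rw [← hP₁, Polynomial.coeff_map]; rfl
      rw [h0, h1]
      by_cases hi : i ∈ Finset.range (n + 1)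
      · rw [norm_sub_rev]
        exact hclose i hi
      · have hlt : n < i := by
          rw [Finset.mem_range, not_lt] at hi
          omega
        rw [charpoly_coeff_eq_zero_of_lt ρ τ₀ hlt, charpoly_coeff_eq_zero_of_lt ρ τ₁ hlt, sub_self,
          norm_zero]
        exact one_pos
    rw [hred, hP₁red]
    simp only [FramedRep.charpoly, hσ₁, hσ'₁]
  -- (2) `T` contains the dense set of good Frobenii
  have hS := Filter.eventually_cofinite.mp (FramedGaloisRep.hasResidualPair_iff.mp h)
  have hdense : Dense T := by
    refine (absoluteGaloisGroup.frobenius_dense chebotarev_artinRep_holds K _ hS).mono ?_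
    rintro φ ⟨v, hv, 𝔓, h𝔓, hφ⟩
    simp only [Set.mem_setOf_eq, not_not] at hv
    obtain ⟨-, -, -, P, P₁, P₂, hP, hP₁, hP₂, hred⟩ := hv
    refine ⟨P, (hP 𝔓 h𝔓 φ hφ).symm, ?_⟩
    rw [hred, hP₁ 𝔓 h𝔓 φ hφ, hP₂ 𝔓 h𝔓 φ hφ]
  exact hTc.closure_eq.symm.trans hdense.closure_eq

end Summit.Langlands.Langlands.Cruxes.StableYoshidaCongruence.BurkhardtWeddleTwoThreeAnchor

end
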